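import Mathlib
import Summits.Ventures.PercRepro2.Defs
import Summits.Ventures.PercRepro2.Independence
import Summits.Ventures.PercRepro2.Graph
import Summits.Ventures.PercRepro2.Exploration
import Summits.Ventures.PercRepro2.Induced
import Summits.Ventures.PercRepro2.R2PrimeThreeReduction
import Summits.Ventures.PercRepro2.YBridge
import Summits.Ventures.PercRepro2.HCov
import Summits.Ventures.PercRepro2.HCovFns
import Summits.Ventures.PercRepro2.HCovCubic
import Summits.Ventures.PercRepro2.TriDisagreement
import Summits.Ventures.PercRepro2.TriDisagreementPinned
import Summits.Ventures.PercRepro2.HubModel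
import Summits.Ventures.PercRepro2.HubLaw
import Summits.Ventures.PercRepro2.HubRootLaw
import Summits.Ventures.PercRepro2.HubConn
import Summits.Ventures.PercRepro2.HubBernstein
import Summits.Ventures.PercRepro2.HubGc
import Summits.Ventures.PercRepro2.HubKron
import Summits.Ventures.PercRepro2.HubKernelP1
import Summits.Ventures.PercRepro2.HubTyped

/-!
# Exchanging two copies on one bundle
(blind cell PercRepro2, typer-1 g8; the typed R theorem, part T1b, first half)

Exchanging two copies on the edges of one root bundle is a bijection of the typed root triples
(`typed_swap12`, `typed_swap23`: open counts and pinning are copy-symmetric) which exchanges the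
two corresponding root-bundle states of that bundle and nothing else (`wOf_swap12`,
`wOf_swap23`).  Hence the root count `rho` is invariant under these exchanges (`rho_swap12`,
`rho_swap23`).  `HubTypedProfile.lean` turns this into «`rho` depends only on the profile».
-/

namespace Summit.Ventures.PercRepro2.Hub

open Classical

section Swap

variable {V : Type*} {E : Type*} [Fintype E] [DecidableEq E] [DecidableEq V]
  {ends : E → Sym2 V} {μ : Mark → V}

/-- Exchange `x` with `y` on the edges of `B`. -/
noncomputable def swapOn (B : Finset E) (x y : Config E) : Config E :=
  fun e => if e ∈ B then y e else x e

/-- Exchange the first two copies on the edges of `B`. -/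
noncomputable def swap12T (B : Finset E) (t : Triple E) : Triple E :=
  (swapOn B t.1 t.2.1, swapOn B t.2.1 t.1, t.2.2)

/-- Exchange the last two copies on the edges of `B`. -/
noncomputable def swap23T (B : Finset E) (t : Triple E) : Triple E :=
  (t.1, swapOn B t.2.1 t.2.2, swapOn B t.2.2 t.2.1)

omit [Fintype E] in
/-- `swapOn` is an involution. -/
lemma swapOn_swapOn (B : Finset E) (x y : Config E) :
    swapOn B (swapOn B x y) (swapOn B y x) = x := by
  funext e
  by_cases he : e ∈ B <;> simp [swapOn, he]

omit [Fintype E] in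
/-- The copy exchanges are involutions. -/
lemma swap12T_swap12T (B : Finset E) (t : Triple E) : swap12T B (swap12T B t) = t := by
  simp only [swap12T, swapOn_swapOn]

omit [Fintype E] in
/-- The copy exchanges are involutions. -/
lemma swap23T_swap23T (B : Finset E) (t : Triple E) : swap23T B (swap23T B t) = t := by
  simp only [swap23T, swapOn_swapOn]

omit [Fintype E] in
/-- The typed triples are closed under exchanging the first two copies. -/
lemma typed_swap12 (B : Finset E) {F : Finset E} {z : Config E} {τ : E → ℕ} {t : Triple E}
    (ht : Typed F z τ t) : Typed F z τ (swap12T B t) := by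
  obtain ⟨hpin, hcount⟩ := ht
  constructor
  · intro e he
    have h := hpin e he
    simp only [swap12T, swapOn]
    by_cases hB : e ∈ B <;> simp [hB, h.1, h.2.1, h.2.2]
  · intro e he
    have h := hcount e he
    simp only [swap12T, swapOn, openCount] at h ⊢
    by_cases hB : e ∈ B
    · simp only [hB, if_true]
      omega
    · simp only [hB, if_false]
      exact h

omit [Fintype E] in
/-- The typed triples are closed under exchanging the last two copies. -/
lemma typed_swap23 (B : Finset E) {F : Finset E} {z : Config E} {τ : E → ℕ} {t : Triple E}
    (ht : Typed F z τ t) : Typed F z τ (swap23T B t) := by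
  obtain ⟨hpin, hcount⟩ := ht
  constructor
  · intro e he
    have h := hpin e he
    simp only [swap23T, swapOn]
    by_cases hB : e ∈ B <;> simp [hB, h.1, h.2.1, h.2.2]
  · intro e he
    have h := hcount e he
    simp only [swap23T, swapOn, openCount] at h ⊢
    by_cases hB : e ∈ B
    · simp only [hB, if_true]
      omega
    · simp only [hB, if_false]
      exact h

omit [DecidableEq E] in
/-- Two configurations agreeing on a bundle have the same state of that bundle. -/
lemma rootState_apply_congr {ω ω' : Config E} (j : Fin 7)
    (h : ∀ e ∈ bundleEdges ends μ j, ω e = ω' e) : rootState ends μ ω j = rootState ends μ ω' j := by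
  have := dependsOn_mem_iff (dependsOn_rootState_apply ends μ j (rootState ends μ ω j)) h
  exact (this.1 rfl).symm

/-- The state of a bundle after exchanging on it is the state of the other configuration. -/
lemma rootState_swapOn_self (i : Fin 7) (x y : Config E) :
    rootState ends μ (swapOn (bundleEdges ends μ i) x y) i = rootState ends μ y i :=
  rootState_apply_congr i fun e he => by simp [swapOn, he]

/-- The state of another bundle is unchanged by an exchange (injective marking). -/
lemma rootState_swapOn_ne (hinj : Function.Injective μ) {i j : Fin 7} (hij : j ≠ i)
    (x y : Config E) :
    rootState ends μ (swapOn (bundleEdges ends μ i) x y) j = rootState ends μ x j :=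
  rootState_apply_congr j fun e he => by
    have : e ∉ bundleEdges ends μ i := fun hi =>
      Set.disjoint_left.1 (disjoint_bundleEdges ends μ hinj hij) he hi
    simp [swapOn, this]

/-- Exchange the first two states of bundle `i`. -/
def swapW12 (i : Fin 7) (w : WTriple) : WTriple :=
  (Function.update w.1 i (w.2.1 i), Function.update w.2.1 i (w.1 i), w.2.2)

/-- Exchange the last two states of bundle `i`. -/
def swapW23 (i : Fin 7) (w : WTriple) : WTriple :=
  (w.1, Function.update w.2.1 i (w.2.2 i), Function.update w.2.2 i (w.2.1 i))

/-- The state exchanges are involutions. -/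
lemma swapW12_swapW12 (i : Fin 7) (w : WTriple) : swapW12 i (swapW12 i w) = w := by
  simp [swapW12]

/-- The state exchanges are involutions. -/
lemma swapW23_swapW23 (i : Fin 7) (w : WTriple) : swapW23 i (swapW23 i w) = w := by
  simp [swapW23]

/-- Exchanging the first two copies on bundle `i` exchanges the first two states of `i`. -/
lemma wOf_swap12 (hinj : Function.Injective μ) (i : Fin 7) (t : Triple E) :
    wOf ends μ (swap12T (bundleEdges ends μ i) t) = swapW12 i (wOf ends μ t) := by
  refine Prod.ext (funext fun j => ?_) (Prod.ext (funext fun j => ?_) rfl)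
  · show rootState ends μ (swapOn (bundleEdges ends μ i) t.1 t.2.1) j =
      Function.update (rootState ends μ t.1) i (rootState ends μ t.2.1 i) j
    by_cases hj : j = i
    · subst hj
      rw [Function.update_self, rootState_swapOn_self]
    · rw [Function.update_of_ne hj, rootState_swapOn_ne hinj hj]
  · show rootState ends μ (swapOn (bundleEdges ends μ i) t.2.1 t.1) j =
      Function.update (rootState ends μ t.2.1) i (rootState ends μ t.1 i) j
    by_cases hj : j = i
    · subst hj
      rw [Function.update_self, rootState_swapOn_self]
    · rw [Function.update_of_ne hj, rootState_swapOn_ne hinj hj]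

/-- Exchanging the last two copies on bundle `i` exchanges the last two states of `i`. -/
lemma wOf_swap23 (hinj : Function.Injective μ) (i : Fin 7) (t : Triple E) :
    wOf ends μ (swap23T (bundleEdges ends μ i) t) = swapW23 i (wOf ends μ t) := by
  refine Prod.ext rfl (Prod.ext (funext fun j => ?_) (funext fun j => ?_))
  · show rootState ends μ (swapOn (bundleEdges ends μ i) t.2.1 t.2.2) j =
      Function.update (rootState ends μ t.2.1) i (rootState ends μ t.2.2 i) j
    by_cases hj : j = i
    · subst hj
      rw [Function.update_self, rootState_swapOn_self]
    · rw [Function.update_of_ne hj, rootState_swapOn_ne hinj hj]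
  · show rootState ends μ (swapOn (bundleEdges ends μ i) t.2.2 t.2.1) j =
      Function.update (rootState ends μ t.2.2) i (rootState ends μ t.2.1 i) j
    by_cases hj : j = i
    · subst hj
      rw [Function.update_self, rootState_swapOn_self]
    · rw [Function.update_of_ne hj, rootState_swapOn_ne hinj hj]

/-- **The root count is invariant under exchanging the first two states of a bundle.** -/
theorem rho_swap12 (hinj : Function.Injective μ) (F : Finset E) (z : Config E) (τ : E → ℕ)
    (i : Fin 7) (w : WTriple) : rho ends μ F z τ (swapW12 i w) = rho ends μ F z τ w := by
  unfold rho
  refine Finset.card_nbij' (swap12T (bundleEdges ends μ i)) (swap12T (bundleEdges ends μ i))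
    ?_ ?_ ?_ ?_
  · intro t ht
    rw [Finset.mem_coe, Finset.mem_filter, mem_tset] at ht ⊢
    refine ⟨typed_swap12 _ ht.1, ?_⟩
    rw [wOf_swap12 hinj, ht.2, swapW12_swapW12]
  · intro t ht
    rw [Finset.mem_coe, Finset.mem_filter, mem_tset] at ht ⊢
    refine ⟨typed_swap12 _ ht.1, ?_⟩
    rw [wOf_swap12 hinj, ht.2]
  · intro t _
    exact swap12T_swap12T _ t
  · intro t _
    exact swap12T_swap12T _ t

/-- **The root count is invariant under exchanging the last two states of a bundle.** -/
theorem rho_swap23 (hinj : Function.Injective μ) (F : Finset E) (z : Config E) (τ : E → ℕ)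
    (i : Fin 7) (w : WTriple) : rho ends μ F z τ (swapW23 i w) = rho ends μ F z τ w := by
  unfold rho
  refine Finset.card_nbij' (swap23T (bundleEdges ends μ i)) (swap23T (bundleEdges ends μ i))
    ?_ ?_ ?_ ?_
  · intro t ht
    rw [Finset.mem_coe, Finset.mem_filter, mem_tset] at ht ⊢
    refine ⟨typed_swap23 _ ht.1, ?_⟩
    rw [wOf_swap23 hinj, ht.2, swapW23_swapW23]
  · intro t ht
    rw [Finset.mem_coe, Finset.mem_filter, mem_tset] at ht ⊢
    refine ⟨typed_swap23 _ ht.1, ?_⟩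
    rw [wOf_swap23 hinj, ht.2]
  · intro t _
    exact swap23T_swap23T _ t
  · intro t _
    exact swap23T_swap23T _ t

end Swap

end Summit.Ventures.PercRepro2.Hub
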